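import Summits.NavierStokesRegularity.JiaSverakCAP.PencilEigenvalueWindow
import Summits.NavierStokesRegularity.JiaSverakCAP.PreconditionedDetSign
import HarnessLib

/-!
# The DET-2pd chain assembled: two certified determinant-sign tests at the window's end points ⇒ a real eigenvalue of the
# pencil inside the window (`JiaSverakCAP.Det2pdChain`)

HONEST FRAMING (audit cell `pub-nsjs`, papers/NavierStokesRegularity/ns-jia-sverak; seat B gen 15). Abstract; asserts nothing
about Navier–Stokes and discharges none of the cell's paper-level hypotheses. It states, as ONE kernel theorem, the implication
the cell's verdict of record rests on (STATUS gen 14: "DET-2pd ⇒ a real eigenvalue of `𝓛_Ũ|anti2` in `(z₋, z₊)`, conditional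
on LEMMA C′(Ũ), LEMMA Y, LEMMA Q1, LEMMA LM + monotonicity + LEMMA R"):

**`exists_eigenvector_of_signCerts`.** Let `D : WindowInverse L J w g S a b` (two-sided inverses `R_z` of the modified pencil
`L − z J + (lift w g S) J` on `[a, b]` with `‖J R_z‖ ≤ M`; in the cell this is LEMMA C′(Ũ) + monotonicity, `M = 1/δ′(z₊)`), let
`0 < det S` (the lift `S′ = diag(s_c)`, `s_c > 0`), and at each end point `c ∈ {a, b}` let a sign certificate `SignCert (C(c)) Mt_c`
for the W–A matrix `C(c) = S⁻¹ − T(c)` be given — produced by EITHER test of `PreconditionedDetSign` after positive diagonal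
scaling: `SignTest.cert` (#1: `θ ≥ ‖1 − P Mt‖`, `π ≥ ‖P‖`, `η ≥ ‖Mt − DL C DR‖`, `θ + π η < 1` — the cell's `κ_pd`) or
`PosDefTest.cert` (#2: `Mtᵀ Mt − η² 1` positive definite, `η ≥ ‖Mt − DL C DR‖` — the cell's exact-`LDLᵀ` test). In the cell `Mt` =
the two-engine midpoint data `M̃_pd`, `DL = DR = diag(s_c^{3/4})`, and `η` = the structure-lemma bound `‖DΞD‖₂ + ‖DED‖₂ (+ data
radii)` built from certified residual norms — LEMMA Y and LEMMA Q1 enter HERE, in certifying `η` and `Mt`. If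
`det Mt_a · det Mt_b < 0` then `∃ z ∈ (a, b), ∃ u : V, u ≠ 0 ∧ L u = z • J u`.

**`exists_eigenvector_of_coercive_signCerts`** is the same theorem in the H1–H5 form of the cell's DET2D-HYPOTHESES: instead of
`WindowInverse` it takes the two-sided inverses `R z` on `[a, b]` and ONE coercivity inequality `δ ‖J u‖² ≤ ⟪G_b u, J u⟫`, `δ > 0`
(monotonicity in `z` and `‖J R_z‖ ≤ δ⁻¹` being theorems of `PencilEigenvalueWindow`), and `det_diagonal_pos` discharges `0 < det S`
for `S = diag(s_c)`, `s_c > 0`.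

So the hypotheses of the verdict are, exactly: the fields of `WindowInverse` (paper-level LEMMA C′(Ũ) as a statement about
`𝓛_Ũ`), the numeric fields of the two tests (certified arithmetic on certified data, modulo LEMMA Y / Q1 inside `η`, `Mt`),
`0 < det S`, and the signs of two exact rational determinants. LEMMA R (the W–A dictionary), "monotonicity ⇒ continuity of
`det C(z)`", the intermediate value step and the TEST-PD / `σ_min` sign logic are no longer hypotheses: they are the imported
kernel theorems. [folklore]
-/

open scoped BigOperators Matrix Matrix.Norms.L2Operator
open Set

noncomputable section

namespace Summit.NavierStokesRegularity.JiaSverakCAP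

namespace Det2pdChain

open Literature.Analysis.OperatorTheory.WeinsteinAronszajnPencil PencilEigenvalueWindow PreconditionedDetSign

variable {ι : Type*} [Fintype ι] [DecidableEq ι]

/-- The conclusion of a passed sign test, as a proof-carrying record: `det C ≠ 0` and `det C` has the sign of the midpoint
determinant `det Mt`. (A structure in `Type`, deliberately not a `Prop` definition: this cell topic registers no obligations.)
[folklore] -/
structure SignCert (C Mt : Matrix ι ι ℝ) : Type where
  det_ne_zero : C.det ≠ 0
  pos_iff : (0 < C.det ↔ 0 < Mt.det)
  neg_iff : (C.det < 0 ↔ Mt.det < 0)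

/-- `SignCert` from the conjunction produced by the tests of `PreconditionedDetSign`. [folklore] -/
def SignCert.of_and {C Mt : Matrix ι ι ℝ}
    (h : C.det ≠ 0 ∧ (0 < C.det ↔ 0 < Mt.det) ∧ (C.det < 0 ↔ Mt.det < 0)) : SignCert C Mt :=
  ⟨h.1, h.2.1, h.2.2⟩

/-- Two-sided scaling by positive-determinant matrices preserves `0 < det`. [folklore] -/
lemma det_scaled_pos_iff (DL C DR : Matrix ι ι ℝ) (hL : 0 < DL.det) (hR : 0 < DR.det) :
    (0 < (DL * C * DR).det ↔ 0 < C.det) := by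
  rw [Matrix.det_mul, Matrix.det_mul]
  refine ⟨fun h => ?_, fun h => mul_pos (mul_pos hL h) hR⟩
  by_contra hc
  have hc' : C.det ≤ 0 := not_lt.mp hc
  nlinarith [mul_pos hL hR, mul_nonneg (mul_pos hL hR).le (neg_nonneg.mpr hc')]

/-- Two-sided scaling by positive-determinant matrices preserves `det < 0`. [folklore] -/
lemma det_scaled_neg_iff (DL C DR : Matrix ι ι ℝ) (hL : 0 < DL.det) (hR : 0 < DR.det) :
    ((DL * C * DR).det < 0 ↔ C.det < 0) := by
  rw [Matrix.det_mul, Matrix.det_mul]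
  refine ⟨fun h => ?_, fun h => mul_neg_of_neg_of_pos (mul_neg_of_pos_of_neg hL h) hR⟩
  by_contra hc
  have hc' : 0 ≤ C.det := not_lt.mp hc
  nlinarith [mul_pos hL hR, mul_nonneg (mul_pos hL hR).le hc']

/-- A sign certificate for the scaled matrix `DL C DR` is one for `C`. [folklore] -/
def signCert_of_scaled {DL C DR Mt : Matrix ι ι ℝ} (hL : 0 < DL.det) (hR : 0 < DR.det)
    (h : SignCert (DL * C * DR) Mt) : SignCert C Mt := by
  obtain ⟨hne, hpos, hneg⟩ := h
  refine ⟨fun hC => hne ?_, (det_scaled_pos_iff DL C DR hL hR).symm.trans hpos,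
    (det_scaled_neg_iff DL C DR hL hR).symm.trans hneg⟩
  rw [Matrix.det_mul, Matrix.det_mul, hC, mul_zero, zero_mul]

/-- **Test #1 data** (`det2pd_cert.py`): positive-determinant scalings `DL, DR`, a midpoint `Mt` of `DL C DR`, a preconditioner
`P`, and bounds `θ ≥ ‖1 − P Mt‖₂`, `π ≥ ‖P‖₂`, `η ≥ ‖Mt − DL C DR‖₂` with `θ + π η < 1`. [folklore] -/
structure SignTest (C : Matrix ι ι ℝ) where
  DL : Matrix ι ι ℝ
  DR : Matrix ι ι ℝ
  Mt : Matrix ι ι ℝ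
  P : Matrix ι ι ℝ
  θ : ℝ
  π : ℝ
  η : ℝ
  hDL : 0 < DL.det
  hDR : 0 < DR.det
  hθ : ‖(1 : Matrix ι ι ℝ) - P * Mt‖ ≤ θ
  hπ : ‖P‖ ≤ π
  hη : ‖Mt - DL * C * DR‖ ≤ η
  hκ : θ + π * η < 1

/-- A passed test #1 certifies the sign. [folklore] -/
def SignTest.cert {C : Matrix ι ι ℝ} (t : SignTest C) : SignCert C t.Mt :=
  signCert_of_scaled t.hDL t.hDR
    (SignCert.of_and (det_pos_iff_of_norm_test t.P t.Mt (t.DL * C * t.DR) t.θ t.π t.η t.hθ t.hπ t.hη t.hκ))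

/-- Test #1 from Frobenius / entrywise data (`‖·‖₂ ≤ ‖·‖_F`). [folklore] -/
def SignTest.ofFrobenius (C DL DR Mt P ρ : Matrix ι ι ℝ) (θ π r : ℝ) (hDL : 0 < DL.det) (hDR : 0 < DR.det)
    (hθ : Real.sqrt (∑ i, ∑ j, ((1 : Matrix ι ι ℝ) - P * Mt) i j ^ 2) ≤ θ)
    (hπ : Real.sqrt (∑ i, ∑ j, P i j ^ 2) ≤ π) (hρ : ∀ i j, |(DL * C * DR) i j - Mt i j| ≤ ρ i j)
    (hr : Real.sqrt (∑ i, ∑ j, ρ i j ^ 2) ≤ r) (hκ : θ + π * r < 1) : SignTest C where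
  DL := DL
  DR := DR
  Mt := Mt
  P := P
  θ := θ
  π := π
  η := r
  hDL := hDL
  hDR := hDR
  hθ := (l2_opNorm_le_sqrt_sum_sq _).trans hθ
  hπ := (l2_opNorm_le_sqrt_sum_sq P).trans hπ
  hη := (l2_opNorm_sub_le_of_abs_le _ Mt ρ hρ).trans hr
  hκ := hκ

/-- **Test #2 data** (`det2pd_certB.py`): positive-determinant scalings, a midpoint `Mt`, a radius `η ≥ ‖Mt − DL C DR‖₂`, and
positive definiteness of `Mtᵀ Mt − η² 1` (exact `LDLᵀ`). [folklore] -/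
structure PosDefTest (C : Matrix ι ι ℝ) where
  DL : Matrix ι ι ℝ
  DR : Matrix ι ι ℝ
  Mt : Matrix ι ι ℝ
  η : ℝ
  hDL : 0 < DL.det
  hDR : 0 < DR.det
  hpos : (Mtᵀ * Mt - η ^ 2 • (1 : Matrix ι ι ℝ)).PosDef
  hη : ‖Mt - DL * C * DR‖ ≤ η

/-- A passed test #2 certifies the sign. [folklore] -/
def PosDefTest.cert {C : Matrix ι ι ℝ} (t : PosDefTest C) : SignCert C t.Mt :=
  signCert_of_scaled t.hDL t.hDR (SignCert.of_and (det_pos_iff_of_posDef_test t.Mt (t.DL * C * t.DR) t.η t.hpos t.hη))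

section Chain

variable {V : Type*} [AddCommGroup V] [Module ℝ V]
variable {E : Type*} [NormedAddCommGroup E] [NormedSpace ℝ E]
variable {L J : V →ₗ[ℝ] E} {w : ι → E} {g : ι → E →L[ℝ] ℝ} {S : Matrix ι ι ℝ} {a b : ℝ}

/-- **DET-2pd ⇒ eigenvalue, kernel form.** Window-inverse data on `[a, b]`, `0 < det S`, sign certificates for
`C(a) = S⁻¹ − T(a)` and `C(b)` (from either test), and opposite signs of the two midpoint determinants force a non-zero kernel
vector of the pencil `L − z J` in the domain for some `z ∈ (a, b)`. [folklore] -/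
theorem exists_eigenvector_of_signCerts (D : WindowInverse L J w g S a b) (hab : a ≤ b) (hS : 0 < S.det)
    {Mta Mtb : Matrix ι ι ℝ} (ha : SignCert (S⁻¹ - T D a) Mta) (hb : SignCert (S⁻¹ - T D b) Mtb)
    (hsign : Mta.det * Mtb.det < 0) : ∃ z ∈ Ioo a b, ∃ u : V, u ≠ 0 ∧ L u = z • J u := by
  refine exists_eigenvector_of_detC_mul_neg D hab hS ?_
  rcases mul_neg_iff.mp hsign with ⟨h1, h2⟩ | ⟨h1, h2⟩
  · exact mul_neg_of_pos_of_neg (ha.pos_iff.mpr h1) (hb.neg_iff.mpr h2)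
  · exact mul_neg_of_neg_of_pos (ha.neg_iff.mpr h1) (hb.pos_iff.mpr h2)

/-- The same with two test-#1 packages (the cell's implementation #1 at both end points). [folklore] -/
theorem exists_eigenvector_of_signTests (D : WindowInverse L J w g S a b) (hab : a ≤ b) (hS : 0 < S.det)
    (ta : SignTest (S⁻¹ - T D a)) (tb : SignTest (S⁻¹ - T D b)) (hsign : ta.Mt.det * tb.Mt.det < 0) :
    ∃ z ∈ Ioo a b, ∃ u : V, u ≠ 0 ∧ L u = z • J u :=
  exists_eigenvector_of_signCerts D hab hS ta.cert tb.cert hsign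

/-- The same with two test-#2 packages (the cell's implementation #2 at both end points). [folklore] -/
theorem exists_eigenvector_of_posDefTests (D : WindowInverse L J w g S a b) (hab : a ≤ b) (hS : 0 < S.det)
    (ta : PosDefTest (S⁻¹ - T D a)) (tb : PosDefTest (S⁻¹ - T D b)) (hsign : ta.Mt.det * tb.Mt.det < 0) :
    ∃ z ∈ Ioo a b, ∃ u : V, u ≠ 0 ∧ L u = z • J u :=
  exists_eigenvector_of_signCerts D hab hS ta.cert tb.cert hsign

end Chain

section CoerciveChain

/-! ### The H1–H5 form: hypotheses stated directly on `L, J, ψ, S′, R_z, δ′` (no `WindowInverse` packaging) -/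

open scoped RealInnerProductSpace

variable {V : Type*} [AddCommGroup V] [Module ℝ V]
variable {E : Type*} [NormedAddCommGroup E] [InnerProductSpace ℝ E]
variable {L J : V →ₗ[ℝ] E} {w : ι → E} {g : ι → E →L[ℝ] ℝ} {S : Matrix ι ι ℝ} {a b : ℝ}

/-- The lift matrix of the cell is `S′ = diag(s_c)` with `s_c > 0`; its determinant is positive. [folklore] -/
lemma det_diagonal_pos (s : ι → ℝ) (hs : ∀ i, 0 < s i) : 0 < (Matrix.diagonal s).det := by
  rw [Matrix.det_diagonal]
  exact Finset.prod_pos fun i _ => hs i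

/-- **DET-2pd ⇒ eigenvalue, H1–H5 form** (DET2D-HYPOTHESES dictionary made literal). Data: two-sided inverses `R z` of the
modified pencil `G_z = L − z J + (lift w g S) J` for `z ∈ [a, b]` (H1 existence part = LEMMA C′), ONE coercivity inequality
`δ ‖J u‖² ≤ ⟪G_b u, J u⟫` with `δ > 0` at the RIGHT end point (H1 at `z₊`; H2 monotonicity is then `coercive_of_le`), `0 < det S`,
sign certificates (test #1 or #2) for `S⁻¹ − W* R_a W` and `S⁻¹ − W* R_b W` against midpoint matrices `Mta`, `Mtb` (H4/H5 = the
(iv) certificates; their radius `η` may use `‖J R_z‖ ≤ δ⁻¹`, `norm_JR_le_of_coercive`), and `det Mta · det Mtb < 0`. Conclusion (H3 +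
IVT, all kernel): a non-zero `u` in the domain with `L u = z • J u` for some `z ∈ (a, b)`. [folklore] -/
theorem exists_eigenvector_of_coercive_signCerts (R : ℝ → (E →ₗ[ℝ] V))
    (hright : ∀ z ∈ Icc a b, ∀ x : E, pencilMod L J w (gLin g) S z (R z x) = x)
    (hleft : ∀ z ∈ Icc a b, ∀ u : V, R z (pencilMod L J w (gLin g) S z u) = u) {δ : ℝ} (hδ : 0 < δ)
    (hcoer : ∀ u : V, δ * ‖J u‖ ^ 2 ≤ ⟪pencilMod L J w (gLin g) S b u, J u⟫) (hab : a ≤ b) (hS : 0 < S.det)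
    {Mta Mtb : Matrix ι ι ℝ} (ha : SignCert (S⁻¹ - waMatrix J (R a) w (gLin g)) Mta)
    (hb : SignCert (S⁻¹ - waMatrix J (R b) w (gLin g)) Mtb) (hsign : Mta.det * Mtb.det < 0) :
    ∃ z ∈ Ioo a b, ∃ u : V, u ≠ 0 ∧ L u = z • J u :=
  exists_eigenvector_of_signCerts (WindowInverse.ofCoercive R hright hleft hδ hcoer) hab hS ha hb hsign

end CoerciveChain

end Det2pdChain

end Summit.NavierStokesRegularity.JiaSverakCAP

end
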